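import Literature.AlgebraicGeometry.Frobenioids.ArithmeticDivisorsPrimes
import Literature.AlgebraicGeometry.Frobenioids.ArithmeticFrobenioidDivSlim
import Literature.AlgebraicGeometry.Frobenioids.GeometricDivisorPrimes
import HarnessLib

/-!
# Frobenioids I, Examples 6.1 / 6.3: pull-backs of divisors REFLECT divisibility (the hypothesis behind
# "`Φ^rlf` is a monoid on `D`", Prop. 5.3) — PROOF

Mochizuki, *The geometry of Frobenioids I: the general theory*, Kyushu J. Math. **62** (2008) 293–400, Ex. 6.1
p. 109 ("pulling back divisors"), Ex. 6.3 p. 113 ("`Φ`, `B` … are functorial"), Prop. 5.3 p. 103 ("the divisorial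
monoid `Φ^rlf`"). [cite: MochizukiFrdI2008, Ex. 6.3 p.113]

PROOF-ONLY (seat abc-iut-L6-t10 gen 2, S3 sub-DAG holder; L1-lead R89 (1)(r3)). After P53-F1 (abc-iut-L1-d2: for a
general divisorial `Φ` the realified pull-backs need not be injective — witness `ℕ² → ℝ_{≥0}`, `(a,b) ↦ a + b√2`),
abc-iut-w5-d137's `Prop53Sub.lean` states "`Φ^rlf` is a monoid on `D`" under the hypothesis
`PullbacksReflectDvd Φ := ∀ α a b, pull Φ α a ∣ pull Φ α b → a ∣ b`. This file PROVES that hypothesis, in its unfolded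
form, for the two divisor monoids of §6:
* `EffArithDivisor.le_of_pullback_le` / `arithDivisorFunctor_pull_dvd_imp` — for the arithmetic `Φ` of Ex. 6.3
  (`(σ^* D)_w = e(w|v) · D_v`, `e ≥ 1`, every place of `M` lies below a place of `L`);
* `GeometricDivisorData.le_of_pull_le` / `GeometricDivisorData.pullPhi_dvd_imp` — for the geometric `Φ` of Ex. 6.1
  (same shape: `ram ≥ 1`, `over` surjective; divisibility INSIDE `Φ(L)` via the v4 closure field `sub_mem`).
The named slot `FrdI.Prop53Sub.PullbacksReflectDvd (arithDivisorFunctor F K)` is then a one-liner once that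
statements file is built. No definitions; nothing here bears on [IUTchIII] or asserts anything about abc.
-/

noncomputable section

namespace Literature.AlgebraicGeometry.Frobenioids

open CategoryTheory Opposite Function NumberField

/-! ### Arithmetic divisors: `σ^* D ≤ σ^* E ⟹ D ≤ E` -/

namespace EffArithDivisor

variable {M : Type} [Field M] [NumberField M] {L : Type} [Field L] [NumberField L]

/-- Pull-back of effective arithmetic divisors REFLECTS the coordinatewise order: if `σ^* D ≤ σ^* E` then `D ≤ E`
(compare at a place `w` of `L` above each place `v` of `M`; `e(w|v) ≥ 1`). [cite: MochizukiFrdI2008, Ex. 6.3 p.113] -/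
theorem le_of_pullback_le (σ : M →+* L) {D E : EffArithDivisor M}
    (h : EffArithDivisor.pullback σ D ≤ EffArithDivisor.pullback σ E) : D ≤ E := by
  refine ⟨fun v => ?_, fun v => ?_⟩
  · obtain ⟨w, hw⟩ := ArithPullback.underPlace_surjective σ v
    have hle := h.1 w
    rw [pullback_fst, pullback_fst, hw] at hle
    exact Nat.le_of_mul_le_mul_left hle (Nat.pos_of_ne_zero (ArithPullback.ramIdx_ne_zero σ w.maximalIdeal))
  · obtain ⟨w, hw⟩ := ArithPullback.comap_infinitePlace_surjective σ v
    have hw : w.comap σ = v := hw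
    have hle := h.2 w
    rw [pullback_snd, pullback_snd] at hle
    change D.2 (w.comap σ) ≤ E.2 (w.comap σ) at hle
    rwa [hw] at hle

/-- Divisibility form: `σ^* D ∣ σ^* E` in `Φ(L)` (written multiplicatively) forces `D ∣ E` in `Φ(M)`.
[cite: MochizukiFrdI2008, Ex. 6.3 p.113] -/
theorem dvd_of_pullback_dvd (σ : M →+* L) {D E : EffArithDivisor M}
    (h : Multiplicative.ofAdd (EffArithDivisor.pullback σ D) ∣ Multiplicative.ofAdd (EffArithDivisor.pullback σ E)) :
    Multiplicative.ofAdd D ∣ Multiplicative.ofAdd E := by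
  rw [ofAdd_dvd_ofAdd_iff] at h ⊢
  have hle : D ≤ E := le_of_pullback_le σ ⟨fun v => h.1 v, fun w => h.2 w⟩
  exact ⟨fun v => hle.1 v, fun w => hle.2 w⟩

end EffArithDivisor

section Arith

variable (F : Type) [Field F] [NumberField F] (K : Type) [Field K] [Algebra F K]

/-- **The arithmetic divisor monoid's pull-backs reflect divisibility** (the hypothesis `PullbacksReflectDvd` of
abc-iut-w5-d137's `Prop53Sub.IsMonoidOnRlf`, unfolded): for every arrow `σ : Spec L → Spec M` of `D` and
`a, b ∈ Φ(M)`, `σ^* a ∣ σ^* b ⟹ a ∣ b`. [cite: MochizukiFrdI2008, Ex. 6.3 p.113] -/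
theorem arithDivisorFunctor_pull_dvd_imp {X Y : FinSubextCat F K} (σ : Y ⟶ X)
    (a b : (arithDivisorFunctor F K).obj (op X))
    (h : pull (arithDivisorFunctor F K) σ a ∣ pull (arithDivisorFunctor F K) σ b) : a ∣ b :=
  EffArithDivisor.dvd_of_pullback_dvd σ.toAlgHom.toRingHom
    (D := Multiplicative.toAdd a) (E := Multiplicative.toAdd b) h

end Arith

/-! ### Geometric divisors: `σ^* D ≤ σ^* E ⟹ D ≤ E`, and divisibility inside `Φ(L)` -/

namespace GeometricDivisorData

variable {K : Type} [Field K] {Kt : Type} [Field Kt] [Algebra K Kt] (Γ : GeometricDivisorData K Kt)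

/-- Pull-back of coefficient vectors REFLECTS the coordinatewise order (`ram ≥ 1`, `over` surjective).
[cite: MochizukiFrdI2008, Ex. 6.1 p.109] -/
theorem le_of_pull_le {X Y : FinSubextCat K Kt} (σ : Y ⟶ X) {D E : Γ.primeDiv X →₀ ℕ}
    (h : Γ.pull σ D ≤ Γ.pull σ E) : D ≤ E := fun P => by
  obtain ⟨Q, hQ⟩ := Γ.over_surjective σ P
  have hle := h Q
  rw [pull_apply, pull_apply, hQ] at hle
  exact Nat.le_of_mul_le_mul_left hle (Γ.ram_pos σ Q)

/-- **The geometric divisor monoid's pull-backs reflect divisibility INSIDE `Φ`** (v4 `sub_mem`: a coefficientwise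
difference of Cartier effective divisors is Cartier effective): `σ^* a ∣ σ^* b` in `Φ(L)` ⟹ `a ∣ b` in `Φ(M)`.
[cite: MochizukiFrdI2008, Ex. 6.1 p.109] -/
theorem pullPhi_dvd_imp {X Y : FinSubextCat K Kt} (σ : Y ⟶ X) (a b : Multiplicative (Γ.Phi X))
    (h : Γ.pullPhi σ a ∣ Γ.pullPhi σ b) : a ∣ b := by
  have h' := h
  rw [← ofAdd_toAdd (Γ.pullPhi σ a), ← ofAdd_toAdd (Γ.pullPhi σ b), Γ.ofAdd_dvd_ofAdd_iff Y] at h'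
  obtain ⟨C, hC⟩ := h'
  rw [coe_toAdd_pullPhi, coe_toAdd_pullPhi] at hC
  have hle : ((Multiplicative.toAdd a : Γ.Phi X) : Γ.primeDiv X →₀ ℕ) ≤
      ((Multiplicative.toAdd b : Γ.Phi X) : Γ.primeDiv X →₀ ℕ) :=
    Γ.le_of_pull_le σ (by rw [hC]; exact le_self_add)
  have hmem : ((Multiplicative.toAdd b : Γ.Phi X) : Γ.primeDiv X →₀ ℕ) -
      ((Multiplicative.toAdd a : Γ.Phi X) : Γ.primeDiv X →₀ ℕ) ∈ Γ.Phi X :=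
    Γ.sub_mem X _ _ (Multiplicative.toAdd b).2 (Multiplicative.toAdd a).2 hle
  rw [← ofAdd_toAdd a, ← ofAdd_toAdd b, Γ.ofAdd_dvd_ofAdd_iff X]
  exact ⟨⟨_, hmem⟩, (add_tsub_cancel_of_le hle).symm⟩

end GeometricDivisorData

end Literature.AlgebraicGeometry.Frobenioids

end
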